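import Literature.Geometry.Lorentzian.KlainermanSzeftel2021.JunctionLevels
import Literature.Geometry.Lorentzian.KlainermanSzeftel2021.IterationClosure

/-!
# Giorgi–Klainerman–Szeftel, Part III: every explicit use of the lower bound `J ≥ k_L/2` in the printed proofs, typed as a numerical threshold that the Klainerman–Szeftel floor `J ≥ k_small − 1` also meets (audit item G-1, J-range half: the use-site census)

CITATION HEADER (lean-in-tree rule 2026-08-18).  Companion of `KlainermanSzeftel2021.JunctionLevels` (the STATEMENT-level ledger of
the junction KS Thm 9.6.7 ⇐ GKS Thm 13.6.3: three printed `J`-ranges, four uncovered bottom steps, decay-level and rate ledgers,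
priced interpolation repair).  This module adds the USE-SITE half: where, in the printed proofs of GKS Part III, the lower bound on
`J` is actually invoked, and what each invocation needs.  Texts read:

* `[GKS-v1]` E. Giorgi, S. Klainerman, J. Szeftel, *Wave equations estimates and the nonlinear stability of slowly rotating Kerr
  black holes*, arXiv:2205.14808 v1 (2022), TeX source `FinalKerrarxivversion.tex` (`GKS l.N`; Part III = l.25152–29680) = bib key
  `GiorgiKlainermanSzeftel2022`; `[GKS-J]` the refereed version, Pure Appl. Math. Q. **20** (2024) no. 7, 2865–3849 = bib key
  `GiorgiKlainermanSzeftel2024`, held text `paper:doi-10-4310-pamq-241128023033` (`PAMQ PDF p.N Ln` = page file / line of its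
  text layer; printed page = PDF page − 1).  At every locus below the quoted words agree in the two versions unless a `[J: …]` says
  otherwise (the print renumbers v1's (13.6.2)/(13.6.4) and, at the consumption locus of §3, carries `+ ε(𝔊_{s+3} + ℜ_{s+3})` under its
  new Remark 13.6.6 instead of v1's closing "`≲ ε² ≲ ε₀`" — cell DIVERGENCE.md VER-A16, GAPS.md ADDENDUM (B)-bis; immaterial here).
* `[KS-J]` S. Klainerman, J. Szeftel, *Kerr stability for small angular momentum*, Pure Appl. Math. Q. **19** (2023) no. 3 = bib key
  `KlainermanSzeftel2023`, authors' accepted manuscript HAL hal-04280491 (`HAL p.N`); `[KS-v1]` arXiv:2104.11857 v1, TeX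
  `Main-Kerr-arxiv.tex` (`KS l.N`) = bib key `KlainermanSzeftel2021`.

THE DATA (integers as in `JunctionLevels`: `k_small = ⌊k_large/2⌋ + 1` = `Dag.kSmall`; `k_L = k_large + 7` = `JunctionLevels.kL`,
a value fixed in GKS's introduction only — GKS l.1795, l.1860; PAMQ PDF p.45 L18 — Part III never names `k_large`).  KS iterates
over `k_small − 1 ≤ J ≤ k_large + 6` (`[KS-J]` Thm 9.4.15, HAL p.627; (9.4.35), p.626); GKS Thm 13.6.3 is printed for
`k_L/2 ≤ J ≤ k_L − 1` (GKS l.25955; PAMQ PDF p.627 L64).  THE CENSUS: the lower bound `k_L/2` occurs in Part III of `[GKS-v1]` at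
exactly seven lines (grep of `\frac{k_L}{2}`, `\frac{\kl}{2}` over l.25152–29680): three statements — (13.6.3) l.25906, the
iteration assumption l.25918, Thm 13.6.3 l.25955 — and FOUR USES:
* (U1) l.26570 (PAMQ PDF p.640 L59): "Moreover, since `J ≥ k_L/2` and `k_L` is large, we may assume that `J ≥ 5`" — index room
  for the norm `𝔅^{J−5}[…]` in the estimate that follows;
* (U2) l.26846 (p.649 L16): "… we may assume that `J ≥ 4`";
* (U4) l.29021–29033 (p.697 L32–33, footnote 9 L158): "Since `ω = O(m r^{−2})`, we may absorb the term `I₁` from the LHS for a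
  sufficiently large choice of `J`" [fn: "Recall that the iteration assumption holds for `J ≥ k_L/2` and that `k_L` is chosen large
  enough"], `I₁ = ∫ 4|q|^b ω |Ψ₍₂₎|²`, against the left-hand side `∫ r^{b−1}(1 + |2k−1| m/r)|Ψ₍₂₎|²`, `2k − 1 = −2J + 3`, of the
  Bianchi-pair estimate (eq:general-proposition-second-bianchi-pairs) (Prop. [Prop:Bainchi-pairsEstimates-integrated], l.27808–27830;
  the `|2k−1|` gain comes from Case 2 of its proof, l.27945–27951: "`C = ½Λ₍₂₎trχ − (2k−1)ω … ≳ −|Λ₍₂₎|/r − (m/r²)|2k−1|`");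
* (U5) l.29505–29517 (p.708 L60–62): "Since `ω = O(m r^{−2})`, the term `ω|Ã̲|²` can be absorbed from the LHS for `J` large enough
  (recalling that `J ≥ k_L/2 ≫ 1`)" [sic], against the printed left-hand side `∫ r^{b−1}(1 + |2J−1| m/r)|Ã̲|²` (l.29505–29506; the
  signature there is `k = −J`, for which `|2k − 1| = 2J + 1` — either way a threshold on `J`).
In addition (U3) the five applications of the Bianchi-pair Proposition carry `J`-dependent SIGN hypotheses (`Λ := −2c + 1 + b/2`
of Lemma [Le:BasicBianchiPairs.simple], l.27613–27619, and the sign of `2k − 1`, `k` = signature of `Ψ₍₁₎`): pair (B̃, P̃⁺)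
l.28802–28808 (p.691 L69): `Λ₍₁₎ = J − 2 + δ/2 > 0`, `2k − 1 = 2J − 3 > 0`; pair (P̃⁻, B̲̃) l.29014–29020 (p.696 L94): `Λ₍₂₎ = −1 − δ/2 < 0`,
`2k − 1 = −2J + 3 < 0`; pair (B̲̃, Ã̲) l.29497–29503 (p.707 L94): `Λ₍₂₎ = −δ/2 < 0`, `2k − 1 = −2J − 1 < 0`; the pair of §15.3 Step 2
l.29165–29181 (p.700 L95): `Λ₍₁₎ = J + b/2 > 0`, `2k − 1 = 2J + 1`; pair (Ã, B̃) l.29661: `Λ₍₁₎ = J − 1 + b/2 > 0`, `2k − 1 = 2J − 1`.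

WHAT IS CERTIFIED (0 sorry; `omega` / `linarith` / `nlinarith` on the printed numbers):
* §1 Two integer readings of the printed floor.  Exactly (`k_L ≤ 2J`, the reading of `JunctionLevels.gksRange`) it is
  `k_small + 3 ≤ J`; with natural-number division (`k_L / 2 ≤ J`, the reading of the cell's hypothesis node
  `Ch9Iteration.Thm1363_formB` / `KS_Cor_9_4_21_of_GKS_13_6_3` in `Dag`) it is `k_small + 2 + (k_large mod 2) ≤ J` — one level
  BELOW print for even `k_large` (`natDivFloor_iff`, `natDiv_admits_extra_level`; on the carrier: `OnCarrier.nodeFloor_wider`), equal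
  for odd; so the node assumes GKS's conclusion on `3 + (k_large mod 2)` of KS's steps that print does not state, print leaves 4
  (`JunctionLevels.uncovered_card`; here `card_uncovered_natDiv`).
* §2 Each of (U1)–(U5) is a NUMERICAL threshold on `J`, independent of `k_L`: (U1) `J ≥ 5`, (U2) `J ≥ 4`, (U3) all five sign pairs
  hold from `J ≥ 2` and `δ > 0` (`signs_from_two`; `J ≥ 2` is needed by two of them: `pairBtPtp_needs_two`, `pairPtmBbt_sign_iff`),
  (U4)/(U5) the absorption `L ≤ R + θL, θ ≤ 1/2 ⟹ L ≤ 2R` with `θ = 4C_ω/(c₀|2k−1|)` (`C_ω` from "`ω = O(m r^{−2})`", `c₀` the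
  implicit constant of the printed left-hand side — both PARAMETERS here) is available iff `8C_ω ≤ c₀|2k−1|`
  (`absorbFraction_le_half_iff`), a threshold `2J − 3 ≥ N₀` resp. `2J − 1 ≥ N₀` (or `2J + 1 ≥ N₀`).  KS's floor meets every one of them for
  `k_large` beyond a numerical `K₀`: `k_small − 1 ≤ J ∧ 2n ≤ k_large ⟹ n ≤ J` (`ksFloor_ge`), whence `J ≥ 5, 4, 2` for `k_large ≥ 10`
  and `2J − 3 ≥ N₀` for `k_large ≥ N₀ + 4` (`explicitUses_of_ksFloor`).  This is the kernel form, use by use, of the audit cell's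
  reading (GAPS.md E3 (3), and `JunctionLevels` header §2) that the printed floor `k_L/2` is a STATEMENT-level mismatch: as far as
  the printed text shows, Part III uses it only as "`J` numerically large", which `J ≥ ⌊k_large/2⌋` gives equally under both
  papers' standing `k_large ≫ 1/δ_dec` (GKS l.1699; KS (3.4.1), KS l.6075–6080).  NOT certified: absence of IMPLICIT uses inside
  `≲` (e.g. the `Ψ₍₁₎`-term of Case 2, l.27940, carries `|2k−1| ≤ 2k_L + 1` into the implicit constant; `k_L`-dependent constants are
  admissible in the hierarchy `ε₀, ε ≪ k_large^{−1}`, GKS l.1704, and are not counted).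
* §3 Three decay-side facts not in `JunctionLevels` §4–§5: the tail bound actually used at the single consumption locus of (13.6.3)
  (proof of Thm [Thm:Estimates-forqf] = `[GKS-J]` Thm 14.1.6, l.26215–26229, PDF p.633 L50–p.634 L5: "`ε²∫_{τ₁}^{τ₂} dτ/τ^{1+δ_dec}
  … where we used … `δ < δ_dec < δ_t`" [J: `δ_B`]) — `∫_{τ₁}^{τ₂}τ^{−p} = (τ₁^{1−p} − τ₂^{1−p})/(p−1) ≤ 1/(p−1)` for `p > 1 ≤ τ₁`
  (`tail_bound`); the locus's side condition with KS's rate, `δ < 3δ_dec/4 ⟸ 2δ ≤ δ_dec` (GKS l.24524 "Choosing `δ > 0` such that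
  `2δ ≤ δ_dec`") (`sideCondition_rateJ`); and a parity- and loss-uniform sufficient form of `JunctionLevels.repair_even_iff` /
  `repair_odd_iff`: interpolating rate `1 + 3δ_dec/4` at level `k_small − 1` against no decay at level `k_large + 7 − σ`, any loss
  `σ ≤ 3`, the level `k_small − 1 + 4 ≥ ⌊k_L/2⌋` gets an exponent `> 1` as soon as `11 ≤ δ_dec · k_large` (`interp_partIII_uniform`),
  and not below `≍ 10/δ_dec` (`interp_partIII_fails_below`).
* §4 The same integers on the cell's carrier `Ch9Iteration` (`kL = kLarge + 7`, `kS`, `span`).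

WHAT IS NOT CLAIMED.  Nothing about the Einstein equations or the truth of any estimate; not that Theorem 13.6.3 holds below its
printed floor (under the audit cell's ABSOLUTE RULE only the printed statement is citable, and it says `k_L/2 ≤ J`); the sign of
`I₁` (with `ω < 0` near Kerr it may even be favourable, cf. GKS l.27758–27767) and the `r`-weights of (13.6.3) are not adjudicated.
Census observation of the audit cell `pub-kerr` (GAPS.md G-1/E3, D-2; f3 block 18), UNDER ADJUDICATION there; value = typed
census / precise gap, not summit progress.
-/

noncomputable section

namespace Literature.Geometry.Lorentzian.GiorgiKlainermanSzeftel2022.JFloorUses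

open Literature.Geometry.Lorentzian.KlainermanSzeftel2021
open Literature.Geometry.Lorentzian.KlainermanSzeftel2021.JunctionLevels (kL kL_def ksRange ksRange_eq_Icc gksRange gksRange_eq_Icc
  decayDemandLevel decaySupplyLevel rateJ)
open Literature.Geometry.Lorentzian.GiorgiKlainermanSzeftel2022.InterpolatedRates (interpExponent interpExponent_def)

/-! ## §1 Two integer readings of the printed floor `k_L/2 ≤ J` -/

/-- Exact reading (`k_L ≤ 2J`, as in `JunctionLevels.gksRange`): `⟺ k_small + 3 ≤ J`, both parities.
[cite: GiorgiKlainermanSzeftel2022, Theorem 13.6.3 range, TeX l.25955; GiorgiKlainermanSzeftel2024, Theorem 13.6.3, PAMQ PDF p.627 L64] -/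
theorem printFloor_iff (kLarge J : ℕ) : kL kLarge ≤ 2 * J ↔ kSmall kLarge + 3 ≤ J := by
  simp only [kL_def, kSmall]; omega

/-- Natural-division reading (`k_L / 2 ≤ J`, as in `Ch9Iteration.Thm1363_formB`): `⟺ k_small + 2 + (k_large mod 2) ≤ J`. [folklore] -/
theorem natDivFloor_iff (kLarge J : ℕ) : kL kLarge / 2 ≤ J ↔ kSmall kLarge + 2 + kLarge % 2 ≤ J := by
  simp only [kL_def, kSmall]; omega

/-- `⌊k_L/2⌋ = k_small + 2 + (k_large mod 2)` (= `JunctionLevels.decayDemandLevel`). [folklore] -/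
theorem kL_div_two (kLarge : ℕ) : kL kLarge / 2 = kSmall kLarge + 2 + kLarge % 2 := by
  simp only [kL_def, kSmall]; omega

/-- The printed floor implies the natural-division floor … [folklore] -/
theorem natDivFloor_of_printFloor {kLarge J : ℕ} (h : kL kLarge ≤ 2 * J) : kL kLarge / 2 ≤ J := by
  simp only [kL_def] at *; omega

/-- … and for even `k_large` admits one more level, `J = k_small + 2`, which print does not: a hypothesis node typed with
`k_L / 2 ≤ J` assumes GKS's conclusion one step below the printed range. [folklore] -/
theorem natDiv_admits_extra_level {kLarge : ℕ} (heven : kLarge % 2 = 0) :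
    kL kLarge / 2 ≤ kSmall kLarge + 2 ∧ ¬ kL kLarge ≤ 2 * (kSmall kLarge + 2) := by
  simp only [kL_def, kSmall]; omega

/-- For odd `k_large` the two readings coincide. [folklore] -/
theorem natDiv_iff_print_of_odd {kLarge : ℕ} (hodd : kLarge % 2 = 1) (J : ℕ) :
    kL kLarge / 2 ≤ J ↔ kL kLarge ≤ 2 * J := by
  simp only [kL_def]; omega

/-- KS's steps below the natural-division floor: `[k_small − 1, ⌊k_L/2⌋)`, `3 + (k_large mod 2)` of them (print: 4,
`JunctionLevels.uncovered_card`). [folklore] -/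
theorem card_uncovered_natDiv (kLarge : ℕ) :
    (Finset.Ico (kSmall kLarge - 1) (kL kLarge / 2)).card = 3 + kLarge % 2 := by
  rw [Nat.card_Ico]; simp only [kL_def, kSmall]; omega

/-- Membership in that set: inside KS's range (`k_small − 1 ≤ J`), below the node's floor. [folklore] -/
theorem mem_uncovered_natDiv {kLarge J : ℕ} :
    J ∈ Finset.Ico (kSmall kLarge - 1) (kL kLarge / 2) ↔ kSmall kLarge - 1 ≤ J ∧ ¬ kL kLarge / 2 ≤ J := by
  rw [Finset.mem_Ico]; omega

/-! ## §2 The uses (U1)–(U5) as numerical thresholds, and KS's floor -/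

/-- KS's floor delivers any numerical threshold: `k_small − 1 ≤ J` and `2n ≤ k_large` give `n ≤ J`. [folklore] -/
theorem ksFloor_ge {kLarge J n : ℕ} (hJ : kSmall kLarge - 1 ≤ J) (hn : 2 * n ≤ kLarge) : n ≤ J := by
  simp only [kSmall] at hJ; omega

/-- The floor itself: `n ≤ k_small − 1 ⟺ 2n ≤ k_large`. [folklore] -/
theorem le_ksFloor_iff (kLarge n : ℕ) : n ≤ kSmall kLarge - 1 ↔ 2 * n ≤ kLarge := by
  simp only [kSmall]; omega

/-- Range form: `J ∈ JunctionLevels.ksRange` and `2n ≤ k_large` give `n ≤ J`. [folklore] -/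
theorem ksRange_ge {kLarge J n : ℕ} (hJ : J ∈ ksRange kLarge) (hn : 2 * n ≤ kLarge) : n ≤ J := by
  rw [ksRange_eq_Icc, Finset.mem_Icc] at hJ; omega

/-- (U1) GKS l.26570 (`[GKS-J]` PDF p.640 L59): "since `J ≥ k_L/2` and `k_L` is large, we may assume that `J ≥ 5`" — from KS's floor
once `k_large ≥ 10`. [cite: GiorgiKlainermanSzeftel2022, ch. 14 "we may assume that J ≥ 5", TeX l.26570; GiorgiKlainermanSzeftel2024, PAMQ PDF p.640 L59] -/
theorem U1_of_ksFloor {kLarge J : ℕ} (hJ : kSmall kLarge - 1 ≤ J) (hk : 10 ≤ kLarge) : 5 ≤ J := ksFloor_ge hJ (by omega)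

/-- (U2) GKS l.26846 (`[GKS-J]` PDF p.649 L16): "… we may assume that `J ≥ 4`" — from KS's floor once `k_large ≥ 8`.
[cite: GiorgiKlainermanSzeftel2022, ch. 14 "we may assume that J ≥ 4", TeX l.26846; GiorgiKlainermanSzeftel2024, PAMQ PDF p.649 L16] -/
theorem U2_of_ksFloor {kLarge J : ℕ} (hJ : kSmall kLarge - 1 ≤ J) (hk : 8 ≤ kLarge) : 4 ≤ J := ksFloor_ge hJ (by omega)

/-- The printed floor gives (U1) as soon as `k_large ≥ 2` (`k_small + 3 ≥ 5`). [folklore] -/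
theorem U1_of_printFloor {kLarge J : ℕ} (hJ : kL kLarge ≤ 2 * J) (hk : 2 ≤ kLarge) : 5 ≤ J := by
  simp only [kL_def] at hJ; omega

/-- `Λ := −2c + 1 + b/2`, the coefficient of Lemma [Le:BasicBianchiPairs.simple], GKS l.27613–27619 (`Λ₍₁₎`, `Λ₍₂₎` for `c = c₍₁₎, c₍₂₎`).
[cite: GiorgiKlainermanSzeftel2022, Lemma (Le:BasicBianchiPairs.simple), TeX l.27613–27619] -/
def Lam (c b : ℝ) : ℝ := -2 * c + 1 + b / 2

/-- Unfolding lemma for `Lam`. [folklore] -/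
@[simp] theorem Lam_def (c b : ℝ) : Lam c b = -2 * c + 1 + b / 2 := rfl

/-- (U3a) Pair (B̃, P̃⁺), GKS l.28802–28808 (`[GKS-J]` PDF p.691 L69): `c₍₁₎ = 1 − (J−2)/2`, `b = 2 + δ` gives `Λ₍₁₎ = J − 2 + δ/2`
("verified for `b = 2+δ`"). [cite: GiorgiKlainermanSzeftel2022, proof of Prop. (Prop:-EstimatesBtPtp3), TeX l.28802–28808; GiorgiKlainermanSzeftel2024, PAMQ PDF p.691 L69] -/
theorem pairBtPtp_Lam (J δ : ℝ) : Lam (1 - (J - 2) / 2) (2 + δ) = J - 2 + δ / 2 := by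
  simp only [Lam_def]; ring

/-- (U3a) Both hypotheses of that application — `Λ₍₁₎ > 0` and `2k − 1 = 2(J−1) − 1 > 0` ("the case `2k−1 > 0`", `k = J − 1` the
signature of `Ψ₍₁₎ = B̃`) — hold from `J ≥ 2`, `δ > 0`. [folklore] -/
theorem pairBtPtp_signs {J : ℕ} {δ : ℝ} (hJ : 2 ≤ J) (hδ : 0 < δ) :
    0 < Lam (1 - ((J : ℝ) - 2) / 2) (2 + δ) ∧ 0 < 2 * ((J : ℤ) - 1) - 1 := by
  refine ⟨?_, by omega⟩
  rw [pairBtPtp_Lam]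
  have : (2 : ℝ) ≤ J := by exact_mod_cast hJ
  linarith

/-- … and `J ≥ 2` is NEEDED there for `δ ≤ 2`: at `J = 1`, `Λ₍₁₎ = −1 + δ/2 ≤ 0` and `2k − 1 = −1 < 0`. [folklore] -/
theorem pairBtPtp_needs_two {δ : ℝ} (hδ : δ ≤ 2) :
    Lam (1 - ((1 : ℝ) - 2) / 2) (2 + δ) ≤ 0 ∧ 2 * ((1 : ℤ) - 1) - 1 < 0 := by
  refine ⟨?_, by norm_num⟩
  simp only [Lam_def]; linarith

/-- (U3b) Pair (P̃⁻, B̲̃), GKS l.29014–29020 (`[GKS-J]` PDF p.696 L94): `c₍₂₎ = 1`, `b = −δ`: `Λ₍₂₎ = −1 − δ/2 < 0`; `Ψ₍₁₎` has signature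
`−J + 2`, "`2k − 1 = 2(−J+2) − 1 = −2J + 3 < 0`" — from `J ≥ 2`, `δ ≥ 0`.
[cite: GiorgiKlainermanSzeftel2022, proof of (eq:lemma-EstimatesBbtPtm3), TeX l.29014–29020; GiorgiKlainermanSzeftel2024, PAMQ PDF p.696 L94] -/
theorem pairPtmBbt_signs {J : ℕ} {δ : ℝ} (hJ : 2 ≤ J) (hδ : 0 ≤ δ) :
    Lam 1 (-δ) < 0 ∧ 2 * (-(J : ℤ) + 2) - 1 < 0 := by
  refine ⟨?_, by omega⟩
  simp only [Lam_def]; linarith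

/-- `−2J + 3 < 0 ⟺ J ≥ 2`: this application NEEDS `J ≥ 2`. [folklore] -/
theorem pairPtmBbt_sign_iff (J : ℕ) : 2 * (-(J : ℤ) + 2) - 1 < 0 ↔ 2 ≤ J := by omega

/-- (U3c) Pair (B̲̃, Ã̲), GKS l.29497–29503 (`[GKS-J]` PDF p.707 L94): `c₍₂₎ = 1/2`, `b = −δ`: `Λ₍₂₎ = −δ/2 < 0` (needs `δ > 0`);
`k = −J`, `2k − 1 = −2J − 1 < 0` for every `J`. [cite: GiorgiKlainermanSzeftel2022, proof of Lemma (lemma:lemma-EstimatesabtBbtm3), TeX l.29497–29503; GiorgiKlainermanSzeftel2024, PAMQ PDF p.707 L94] -/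
theorem pairBbtAbt_signs (J : ℕ) {δ : ℝ} (hδ : 0 < δ) : Lam (1 / 2) (-δ) < 0 ∧ 2 * (-(J : ℤ)) - 1 < 0 := by
  refine ⟨?_, by omega⟩
  simp only [Lam_def]; linarith

/-- (U3d) The pair of §15.3 Step 2, GKS l.29165–29181 (`[GKS-J]` PDF p.700 L95): `c₍₁₎ = 1 − (J+1)/2`, `b = 2 + δ`:
"`Λ₍₁₎ = −2 + (J+1) + 1 + b/2 > 0`"; `Ψ₍₁₎` has signature `J + 1`, `2k − 1 = 2J + 1 > 0` — no condition on `J`.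
[cite: GiorgiKlainermanSzeftel2022, §15.3 Step 2, TeX l.29165–29181; GiorgiKlainermanSzeftel2024, PAMQ PDF p.700 L95] -/
theorem pairStep2_signs (J : ℕ) {δ : ℝ} (hδ : 0 ≤ δ) :
    0 < Lam (1 - ((J : ℝ) + 1) / 2) (2 + δ) ∧ 0 < 2 * ((J : ℤ) + 1) - 1 := by
  refine ⟨?_, by omega⟩
  have : (0 : ℝ) ≤ J := by exact_mod_cast Nat.zero_le J
  simp only [Lam_def]; linarith

/-- (U3e) Pair (Ã, B̃), GKS l.29661: `c₍₁₎ = (2−J)/2`, "`Λ₍₁₎ = J − 1 + b/2 > 0`. We can thus choose `b = 2 + δ`"; `Ψ₍₂₎ = B̃` has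
signature `J − 1`, so `k = J` and `2k − 1 = 2J − 1 > 0` needs `J ≥ 1`. [cite: GiorgiKlainermanSzeftel2022, §15.4 estimate for Ã, TeX l.29661] -/
theorem pairAtBt_signs {J : ℕ} {δ : ℝ} (hJ : 1 ≤ J) (hδ : 0 ≤ δ) :
    0 < Lam ((2 - (J : ℝ)) / 2) (2 + δ) ∧ 0 < 2 * (J : ℤ) - 1 := by
  refine ⟨?_, by omega⟩
  have : (1 : ℝ) ≤ J := by exact_mod_cast hJ
  simp only [Lam_def]; linarith

/-- (U3) From `J ≥ 2` and `δ > 0` alone, all five sign pairs hold. [folklore] -/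
theorem signs_from_two {J : ℕ} {δ : ℝ} (hJ : 2 ≤ J) (hδ : 0 < δ) :
    (0 < Lam (1 - ((J : ℝ) - 2) / 2) (2 + δ) ∧ 0 < 2 * ((J : ℤ) - 1) - 1) ∧
    (Lam 1 (-δ) < 0 ∧ 2 * (-(J : ℤ) + 2) - 1 < 0) ∧
    (Lam (1 / 2) (-δ) < 0 ∧ 2 * (-(J : ℤ)) - 1 < 0) ∧
    (0 < Lam (1 - ((J : ℝ) + 1) / 2) (2 + δ) ∧ 0 < 2 * ((J : ℤ) + 1) - 1) ∧
    (0 < Lam ((2 - (J : ℝ)) / 2) (2 + δ) ∧ 0 < 2 * (J : ℤ) - 1) :=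
  ⟨pairBtPtp_signs hJ hδ, pairPtmBbt_signs hJ hδ.le, pairBbtAbt_signs J hδ, pairStep2_signs J hδ.le,
    pairAtBt_signs (by omega) hδ.le⟩

/-- (U4)/(U5) the absorption step with constants explicit: `L ≤ R + θL`, `θ ≤ 1/2`, `0 ≤ L` give `L ≤ 2R`. [folklore] -/
theorem absorb_of_le_half {L R θ : ℝ} (hL : 0 ≤ L) (hθ : θ ≤ 1 / 2) (h : L ≤ R + θ * L) : L ≤ 2 * R := by
  nlinarith [mul_le_mul_of_nonneg_right hθ hL]

/-- The fraction to absorb at GKS l.29021–29033 (`[GKS-J]` PDF p.697 L32–33, footnote 9 L158) resp. l.29505–29517 (p.708 L60–62):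
`|I₁| ≤ 4C_ω ∫ r^{b−1}(m/r)|Ψ₍₂₎|²` (from "`ω = O(m r^{−2})`": `|q|^b|ω| ≤ C_ω m r^{b−2}`) against the coercive part
`c₀|2k−1| ∫ r^{b−1}(m/r)|Ψ₍₂₎|²` of the printed left-hand side `∫ r^{b−1}(1 + |2k−1| m/r)|Ψ₍₂₎|²` (l.27824–27830, implicit constant
`c₀`): `θ = 4C_ω/(c₀N)`, `N = |2k − 1|` = `|2J − 3|` resp. the printed `|2J − 1|` (`2J + 1` for `k = −J`).  `C_ω`, `c₀` are near-Kerr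
numbers independent of `k_L`;
here parameters. [cite: GiorgiKlainermanSzeftel2022, absorption of I₁ and of ω|Ã̲|², TeX l.29021–29033 and l.29505–29517; GiorgiKlainermanSzeftel2024, PAMQ PDF p.697 L32–33 fn 9 L158 and p.708 L60–62] -/
def absorbFraction (Cω c₀ N : ℝ) : ℝ := 4 * Cω / (c₀ * N)

/-- Absorbable (`θ ≤ 1/2`) iff `8C_ω ≤ c₀N` — a NUMERICAL threshold `N ≥ N₀ := 8C_ω/c₀` on `|2k − 1|`. [folklore] -/
theorem absorbFraction_le_half_iff {Cω c₀ N : ℝ} (hc : 0 < c₀) (hN : 0 < N) :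
    absorbFraction Cω c₀ N ≤ 1 / 2 ↔ 8 * Cω ≤ c₀ * N := by
  unfold absorbFraction
  rw [div_le_iff₀ (mul_pos hc hN)]
  constructor <;> intro h <;> linarith

/-- (U4)/(U5) from KS's floor: `2J − 3 ≥ N₀` (hence `2J − 1 ≥ N₀`, `2J + 1 ≥ N₀`) as soon as `k_large ≥ N₀ + 4`. [folklore] -/
theorem U45_of_ksFloor {kLarge J N₀ : ℕ} (hJ : kSmall kLarge - 1 ≤ J) (hk : N₀ + 4 ≤ kLarge) :
    N₀ ≤ 2 * J - 3 ∧ N₀ ≤ 2 * J - 1 ∧ N₀ ≤ 2 * J + 1 := by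
  simp only [kSmall] at hJ; omega

/-- All explicit thresholds at once from KS's floor: `k_large ≥ max(10, N₀ + 4)` and `k_small − 1 ≤ J` give `J ≥ 5` (U1), `J ≥ 4`
(U2), `J ≥ 2` (U3) and `2J − 3, 2J − 1, 2J + 1 ≥ N₀` (U4, U5). [folklore] -/
theorem explicitUses_of_ksFloor {kLarge J N₀ : ℕ} (hJ : kSmall kLarge - 1 ≤ J) (h10 : 10 ≤ kLarge) (hN : N₀ + 4 ≤ kLarge) :
    5 ≤ J ∧ 4 ≤ J ∧ 2 ≤ J ∧ (N₀ ≤ 2 * J - 3 ∧ N₀ ≤ 2 * J - 1 ∧ N₀ ≤ 2 * J + 1) :=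
  ⟨U1_of_ksFloor hJ h10, U2_of_ksFloor hJ (by omega), ksFloor_ge hJ (by omega), U45_of_ksFloor hJ hN⟩

/-- Range form of the same over `JunctionLevels.ksRange`. [folklore] -/
theorem explicitUses_of_ksRange {kLarge J N₀ : ℕ} (hJ : J ∈ ksRange kLarge) (h10 : 10 ≤ kLarge) (hN : N₀ + 4 ≤ kLarge) :
    5 ≤ J ∧ 4 ≤ J ∧ 2 ≤ J ∧ (N₀ ≤ 2 * J - 3 ∧ N₀ ≤ 2 * J - 1 ∧ N₀ ≤ 2 * J + 1) := by
  rw [ksRange_eq_Icc, Finset.mem_Icc] at hJ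
  exact explicitUses_of_ksFloor (by simp only [kSmall]; omega) h10 hN

/-- Conversely the thresholds are NOT met at the bottom of KS's range for small `k_large` (e.g. `k_large = 8`: `k_small − 1 = 4 < 5`),
so a numerical `K₀` is genuinely required — harmless under `k_large ≫ 1/δ_dec`. [folklore] -/
theorem U1_fails_at_ksFloor_eight : kSmall 8 - 1 < 5 := by simp only [kSmall]; norm_num

/-! ## §3 Decay side: the tail bound, the side condition, a uniform price -/

/-- The tail bound used at the single consumption locus of (13.6.3) (GKS l.26220, "`≲ ε² ∫_{τ₁}^{τ₂} dτ/τ^{1+δ_dec} + …`", both versions;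
v1 closes the display with "`≲ ε² ≲ ε₀`", the print carries the top-order term instead, PDF p.634 L3–12); `[KS-J]`
Remark 9.6.6 "at an integrable rate", HAL p.652 L63–65), on the evaluated antiderivative: for `p > 1`, `1 ≤ τ₁ ≤ τ₂`,
`(τ₁^{1−p} − τ₂^{1−p})/(p − 1) ≤ 1/(p − 1)`. [cite: GiorgiKlainermanSzeftel2022, proof of Thm (Thm:Estimates-forqf), TeX l.26220; KlainermanSzeftel2023, Remark 9.6.6, HAL hal-04280491 p.652 L63–65] -/
theorem tail_bound {p τ₁ τ₂ : ℝ} (hp : 1 < p) (h₁ : 1 ≤ τ₁) (h₁₂ : τ₁ ≤ τ₂) :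
    (τ₁ ^ (1 - p) - τ₂ ^ (1 - p)) / (p - 1) ≤ 1 / (p - 1) := by
  have hp' : 0 < p - 1 := by linarith
  apply div_le_div_of_nonneg_right _ hp'.le
  have hτ₂ : 0 ≤ τ₂ ^ (1 - p) := Real.rpow_nonneg (by linarith) _
  have hτ₁ : τ₁ ^ (1 - p) ≤ 1 := Real.rpow_le_one_of_one_le_of_nonpos h₁ (by linarith)
  linarith

/-- With KS's rate `p = rateJ δ_dec = 1 + 3δ_dec/4` the tail constant is `4/(3δ_dec)`; with GKS's `1 + δ_dec` it is `1/δ_dec`. [folklore] -/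
theorem tail_constants (δ : ℝ) : 1 / (rateJ δ - 1) = 4 / (3 * δ) ∧ 1 / ((1 + δ) - 1) = 1 / δ := by
  refine ⟨?_, by ring_nf⟩
  simp only [rateJ]
  ring_nf

/-- The locus's side condition "`δ < δ_dec`" (GKS l.26222; `[GKS-J]` PDF p.634 L5) with `δ_dec` replaced by KS's `rateJ − 1 = 3δ_dec/4`
follows from GKS's standing choice "`2δ ≤ δ_dec`" (GKS l.24524) and `δ_dec > 0`. [cite: GiorgiKlainermanSzeftel2022, TeX l.26222 and l.24524] -/
theorem sideCondition_rateJ {δ δdec : ℝ} (h2 : 2 * δ ≤ δdec) (hδ : 0 < δdec) : δ < rateJ δdec - 1 := by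
  simp only [rateJ]; linarith

/-- Interpolated exponent between rate `1 + δ_h` at level `k₀` and rate `0` at level `T > k₀`, evaluated at `k₀ + j`, exceeds `1` iff
`j(1 + δ_h) < δ_h(T − k₀)` (cf. `JunctionLevels.interp_gt_one_iff`, span form). [folklore] -/
theorem interp_gt_one_iff' {δh k₀ T j : ℝ} (hT : k₀ < T) :
    1 < interpExponent (1 + δh) k₀ T (k₀ + j) ↔ j * (1 + δh) < δh * (T - k₀) := by
  have hd : 0 < T - k₀ := sub_pos.mpr hT
  simp only [interpExponent_def, add_sub_cancel_left]
  have hx : j / (T - k₀) * (T - k₀) = j := div_mul_cancel₀ j hd.ne'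
  have e : (1 + δh) * (1 - j / (T - k₀)) * (T - k₀) = (1 + δh) * ((T - k₀) - j) := by
    rw [mul_assoc, sub_mul, one_mul, hx]
  constructor
  · intro h
    have h' := mul_lt_mul_of_pos_right h hd
    rw [e, one_mul] at h'
    linarith
  · intro h
    have key : 1 * (T - k₀) < (1 + δh) * (1 - j / (T - k₀)) * (T - k₀) := by
      rw [e, one_mul]; linarith
    exact lt_of_mul_lt_mul_right key hd.le

/-- Uniform sufficient price: `k₀ ≤ k_large/2`, `T ≥ k_large + 4`, rate `rateJ δ_dec`; then `11 ≤ δ_dec·k_large` gives an exponent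
`> 1` at `k₀ + 4`. [folklore] -/
theorem interp_partIII_of_eleven {δdec kLarge k₀ T : ℝ} (hδ0 : 0 < δdec)
    (hk₀ : k₀ ≤ kLarge / 2) (hT : kLarge + 4 ≤ T) (h11 : 11 ≤ δdec * kLarge) :
    1 < interpExponent (rateJ δdec) k₀ T (k₀ + 4) := by
  have hT' : k₀ < T := by nlinarith
  rw [show rateJ δdec = 1 + 3 / 4 * δdec by simp only [rateJ]; ring, interp_gt_one_iff' hT']
  have hspan : kLarge / 2 + 4 ≤ T - k₀ := by linarith
  have h34 : 0 < 3 / 4 * δdec := by linarith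
  calc (4 : ℝ) * (1 + 3 / 4 * δdec) = 4 + 3 * δdec := by ring
    _ < 3 / 4 * δdec * (kLarge / 2 + 4) := by nlinarith
    _ ≤ 3 / 4 * δdec * (T - k₀) := mul_le_mul_of_nonneg_left hspan h34.le

/-- Parity- and loss-uniform form of `JunctionLevels.repair_even_iff` / `repair_odd_iff` on the integer data: rate `rateJ δ_dec` at
level `k_small − 1`, no decay at level `k_large + 7 − σ` for any loss `σ ≤ 3` (BA-PT (9.4.21) is stated at `k_large + 7`); then
`11 ≤ δ_dec · k_large` gives an exponent `> 1` at level `k_small − 1 + 4`, which dominates `⌊k_L/2⌋` (`JunctionLevels.decayDemandLevel`).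
[folklore] -/
theorem interp_partIII_uniform {δdec : ℝ} {kLarge σ : ℕ} (hδ0 : 0 < δdec) (hσ : σ ≤ 3) (h11 : 11 ≤ δdec * kLarge) :
    1 < interpExponent (rateJ δdec) ((kSmall kLarge - 1 : ℕ) : ℝ) ((kLarge + 7 - σ : ℕ) : ℝ) (((kSmall kLarge - 1 : ℕ) : ℝ) + 4) ∧
      decayDemandLevel kLarge ≤ kSmall kLarge - 1 + 4 := by
  refine ⟨?_, by simp only [decayDemandLevel, kL_def, kSmall]; omega⟩
  have hks : kSmall kLarge - 1 = kLarge / 2 := by simp only [kSmall]; omega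
  have hk₀ : ((kSmall kLarge - 1 : ℕ) : ℝ) ≤ (kLarge : ℝ) / 2 := by
    rw [hks]
    have h2 : 2 * (kLarge / 2) ≤ kLarge := Nat.mul_div_le kLarge 2
    have h2' : (2 : ℝ) * ((kLarge / 2 : ℕ) : ℝ) ≤ (kLarge : ℝ) := by exact_mod_cast h2
    linarith
  have hT : (kLarge : ℝ) + 4 ≤ ((kLarge + 7 - σ : ℕ) : ℝ) := by
    have : kLarge + 4 ≤ kLarge + 7 - σ := by omega
    exact_mod_cast this
  exact interp_partIII_of_eleven hδ0 hk₀ hT h11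

/-- … and not much below: with `T = k_large + 7` (no loss), `k₀ = k_large/2` and rate `rateJ δ_dec`, the exponent at `k₀ + 4` is `≤ 1`
whenever `3δ_dec(k_large + 14) ≤ 32 + 24δ_dec` — e.g. `δ_dec·k_large ≤ 10` with `δ_dec ≤ 1/50`: the price is genuinely `≍ 10/δ_dec`,
the order of both papers' `k_large ≫ 1/δ_dec`. [folklore] -/
theorem interp_partIII_fails_below {δdec kLarge : ℝ} (hkL : 0 ≤ kLarge)
    (hsmall : 3 * δdec * (kLarge + 14) ≤ 32 + 24 * δdec) :
    interpExponent (rateJ δdec) (kLarge / 2) (kLarge + 7) (kLarge / 2 + 4) ≤ 1 := by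
  have hT : kLarge / 2 < kLarge + 7 := by linarith
  by_contra hcon
  push Not at hcon
  rw [show rateJ δdec = 1 + 3 / 4 * δdec by simp only [rateJ]; ring, interp_gt_one_iff' hT] at hcon
  nlinarith

/-! ## §4 On the cell's carrier `Ch9Iteration` -/

namespace OnCarrier

/-- `I.kL / 2 = I.kS + 2 + I.kLarge % 2`. [folklore] -/
theorem kL_div_two (I : Ch9Iteration) : I.kL / 2 = I.kS + 2 + I.kLarge % 2 := by
  unfold Ch9Iteration.kL Ch9Iteration.kS kSmall; omega

/-- Exact reading of the printed floor on the carrier: `I.kL ≤ 2J ↔ I.kS + 3 ≤ J`. [folklore] -/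
theorem printFloor_iff (I : Ch9Iteration) (J : ℕ) : I.kL ≤ 2 * J ↔ I.kS + 3 ≤ J := by
  unfold Ch9Iteration.kL Ch9Iteration.kS kSmall; omega

/-- The node's floor `I.kL / 2 ≤ J` (`Thm1363_formB`, `KS_Cor_9_4_21_of_GKS_13_6_3`) follows from the printed one … [folklore] -/
theorem nodeFloor_of_print (I : Ch9Iteration) {J : ℕ} (h : I.kL ≤ 2 * J) : I.kL / 2 ≤ J := by
  unfold Ch9Iteration.kL at *; omega

/-- … and admits `J = I.kS + 2` when `I.kLarge` is even, which print does not (widening witness). [folklore] -/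
theorem nodeFloor_wider (I : Ch9Iteration) (heven : I.kLarge % 2 = 0) :
    I.kL / 2 ≤ I.kS + 2 ∧ ¬ I.kL ≤ 2 * (I.kS + 2) := by
  unfold Ch9Iteration.kL Ch9Iteration.kS kSmall; omega

/-- The carrier's `kL` is `JunctionLevels.kL` of its `kLarge`. [folklore] -/
theorem kL_eq (I : Ch9Iteration) : I.kL = kL I.kLarge := rfl

/-- The four printed-uncovered steps and the decay target `⌊k_L/2⌋ ≤ I.kS − 1 + 4` sit inside the certified KS iteration span
(`IterationClosure`: `I.kS − 1 + I.span = I.kLarge + 7`, `7 ≤ I.span`). [folklore] -/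
theorem uncovered_within_span (I : Ch9Iteration) :
    I.kS - 1 + 4 ≤ I.kLarge + 7 ∧ 4 ≤ I.span ∧ I.kL / 2 ≤ I.kS - 1 + 4 := by
  have h7 := I.seven_le_span
  have hs := I.kS_sub_one_add_span
  refine ⟨by omega, by omega, ?_⟩
  unfold Ch9Iteration.kL Ch9Iteration.kS kSmall; omega

end OnCarrier

end Literature.Geometry.Lorentzian.GiorgiKlainermanSzeftel2022.JFloorUses

end
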